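import Literature.NumberTheory.EllipticCurves.RationalTwoTorsionModPIrreducibleProofs
import Literature.NumberTheory.Automorphic.CDTTheorem722SerreProofs
import HarnessLib

/-!
# The mod `p` representation of the Dénes Frey curve is absolutely irreducible
# (Darmon–Merel 1997, Theorem 2.2)

Topic `Literature/NumberTheory/DiophantineGeometry`; namespace
`Literature.NumberTheory.DiophantineGeometry`. Second companion proof file (theorems only, no
definitions, no named facts) of the named fact
`Literature.NumberTheory.DiophantineGeometry.darmonMerel1997_denesEquation`
(`GeneralizedFermatTwoPowerCoefficient`), after `DenesEquationFreyCurveProofs` (§1 of the printed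
proof). It formalises §2, Theorem 2.2 of H. Darmon, L. Merel, *Winding quotients and some variants
of Fermat's Last Theorem*, J. reine angew. Math. 490 (1997) 81–100 — "The representation `ρ` is
absolutely irreducible", `ρ : G_ℚ → Aut(E[p]) ≃ GL₂(𝔽_p)` the mod `p` representation of the Frey
curve `E : Y² = X(X − aᵖ)(X − 2cᵖ)` of a solution of `aᵖ + bᵖ = 2cᵖ`, `abc ≠ 0` — for every prime
`p ≥ 5` (the source: `p ≥ 7`), **conditionally on the one tree fact**
`Literature.NumberTheory.EllipticCurves.mazurKenku_exists_cyclic_isogeny` (Mazur 1978, Thm. 1 with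
Kenku 1982; hypothesis `hMK`), through the general theorem
`hasIrreducibleModPGaloisRep_of_rational_two_torsion_of_mazurKenku` of
`RationalTwoTorsionModPIrreducibleProofs` (full rational `2`-torsion, DM Lemma 1.2 (1), excludes a
rational `p`-isogeny for `p ≥ 5`: it would give a rational cyclic `4p`-isogeny) and the tree's
`isAbsolutelyIrreducible_of_hasIrreducibleModPGaloisRep` (`CDTTheorem722SerreProofs`: irreducible
and odd in characteristic `≠ 2` is absolutely irreducible, Serre 1987 n° 3.3).

The printed proof of Thm. 2.2 runs instead through Mazur [18] for `p ≥ 17` ("since the curve `E` has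
at least one odd prime of multiplicative reduction") and, for `7 ≤ p ≤ 13`, through the rational
points of `X₀(N)`, `N = 14, 22, 26, 21, 33, 39` ("either cuspidal, or CM": Mazur, Kubert, Kenku);
the Mazur–Kenku fact packages these results on `X₀(N)(ℚ)`, and the road through `X₀(4p)` taken
here needs no integrality of `j`.

* `hasIrreducibleModPGaloisRep_freyCurve_denes_of_mazurKenku` — no `Γ_ℚ`-stable line in `E[q]`
  for every prime `q ≥ 5` (in particular `q = p`);
* `isAbsolutelyIrreducible_freyCurve_denes_of_mazurKenku` — **DM Thm. 2.2 as printed**: every framed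
  model `ρ̄ : Γ_ℚ →ₜ* GL₂(𝔽_q)` of `E[q]` (`IsTorsionGaloisRep`) is absolutely irreducible, `q ≥ 5`;
* `exists_isTorsionGaloisRep_freyCurve_denes` — such framed models exist (the tree's
  `exists_isTorsionGaloisRep`), so the statement is not vacuous.

Not touched here (absent from the tree): DM Lemma 2.1 (Serre conductor `N(ρ) = 2` or `∣ 32`, via the
Tate curve), Thm. 3.1 (Ribet) / Serre's conjecture (tree fact `khare_wintenberger`, unproved), §4,
Thm. 8.1, Cor. 9.1, and Dénes 1952 for `p = 5`.

## References

* H. Darmon, L. Merel, J. reine angew. Math. 490 (1997) 81–100, §2, Thm. 2.2 (p. 8 of the 26-page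
  version) and Lemma 1.2 (1). [DarmonMerel1997]
* B. Mazur, Invent. Math. 44 (1978) 129–162, Thm. 1 [Mazur1978]; M. A. Kenku, J. Number Theory 15
  (1982) 199–202 [Kenku1982]; J.-P. Serre, Duke Math. J. 54 (1987), n° 3.3 [Serre1987].
-/

noncomputable section

open WeierstrassCurve
open Literature.NumberTheory.EllipticCurves Literature.NumberTheory.GaloisRepresentations

namespace Literature.NumberTheory.DiophantineGeometry

section DenesModP

variable {a b c : ℤ} {p : ℕ}

/-- For a solution of `a ^ p + b ^ p = 2 c ^ p` with `a b c ≠ 0`, the root datum of the Frey curve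
`Y ² = X (X − a ^ p) (X − 2 c ^ p)` is nondegenerate: `A B (A + B) = 2 (a b c) ^ p ≠ 0` for
`A = a ^ p`, `B = −2 c ^ p` (as in `DenesEquationFreyCurveProofs.denes_frey_ne_zero`, restated
privately to keep this file's imports light). [cite: DarmonMerel1997, §1 eq. (4)] -/
private theorem denes_root_datum_ne_zero (h : a ^ p + b ^ p = 2 * c ^ p) (h0 : a * b * c ≠ 0) :
    a ^ p * -(2 * c ^ p) * (a ^ p + -(2 * c ^ p)) ≠ 0 := by
  have e : a ^ p * -(2 * c ^ p) * (a ^ p + -(2 * c ^ p)) = 2 * (a * b * c) ^ p := by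
    rw [show a ^ p + -(2 * c ^ p) = -b ^ p by linear_combination h]
    ring
  rw [e]
  exact mul_ne_zero two_ne_zero (pow_ne_zero _ h0)

/-- **Darmon–Merel 1997, Thm. 2.2 (irreducibility over `𝔽_q`), from the Mazur–Kenku fact.**
Granted `mazurKenku_exists_cyclic_isogeny`, for a solution of `a ^ p + b ^ p = 2 c ^ p` with
`a b c ≠ 0` the Frey curve `Y ² = X (X − a ^ p) (X − 2 c ^ p)` (`freyCurve (a ^ p) (-(2 * c ^ p))`)
has no `Γ_ℚ`-stable line in `E[q]`, i.e. no rational `q`-isogeny, for every prime `q ≥ 5`: its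
`2`-torsion is rational (DM Lemma 1.2 (1), `smul_eq_of_two_nsmul_eq_zero_freyCurve`) and
`hasIrreducibleModPGaloisRep_freyCurve_of_mazurKenku` applies. (The source takes `q = p ≥ 7`.)
[cite: DarmonMerel1997, Thm. 2.2] -/
theorem hasIrreducibleModPGaloisRep_freyCurve_denes_of_mazurKenku
    (hMK : mazurKenku_exists_cyclic_isogeny) (h : a ^ p + b ^ p = 2 * c ^ p) (h0 : a * b * c ≠ 0)
    {q : ℕ} (hq : q.Prime) (h5 : 5 ≤ q) :
    (freyCurve (a ^ p) (-(2 * c ^ p))).HasIrreducibleModPGaloisRep q :=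
  hasIrreducibleModPGaloisRep_freyCurve_of_mazurKenku hMK (denes_root_datum_ne_zero h h0) hq h5

/-- **Darmon–Merel 1997, Thm. 2.2, as printed: "The representation `ρ` is absolutely
irreducible"** — for the Frey curve `E : Y ² = X (X − a ^ p) (X − 2 c ^ p)` of a solution of
`a ^ p + b ^ p = 2 c ^ p`, `a b c ≠ 0`, and every prime `q ≥ 5` (the source: `ρ = E[p]`, `p ≥ 7`),
every framed mod `q` representation `ρ̄ : Γ_ℚ →ₜ* GL₂(𝔽_q)` of `E[q]` (`IsTorsionGaloisRep`) is
absolutely irreducible; conditional on the tree fact `mazurKenku_exists_cyclic_isogeny` (Mazur 1978,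
Thm. 1; Kenku 1982). Proof: irreducible over `𝔽_q`
(`hasIrreducibleModPGaloisRep_freyCurve_denes_of_mazurKenku`) and `q ≠ 2`, so absolutely
irreducible by oddness (the tree's `isAbsolutelyIrreducible_of_hasIrreducibleModPGaloisRep`,
Serre 1987 n° 3.3 (b′) ⇒ (b)). [cite: DarmonMerel1997, Thm. 2.2] -/
theorem isAbsolutelyIrreducible_freyCurve_denes_of_mazurKenku
    (hMK : mazurKenku_exists_cyclic_isogeny) (h : a ^ p + b ^ p = 2 * c ^ p) (h0 : a * b * c ≠ 0)
    {q : ℕ} [Fact q.Prime] (h5 : 5 ≤ q) {ρ : ModPGaloisRep ℚ (ZMod q) 2}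
    (hρ : (freyCurve (a ^ p) (-(2 * c ^ p))).IsTorsionGaloisRep q ρ) :
    FramedRep.IsAbsolutelyIrreducible ρ :=
  haveI := isElliptic_freyCurve (denes_root_datum_ne_zero h h0)
  Automorphic.BCDT.isAbsolutelyIrreducible_of_hasIrreducibleModPGaloisRep _ (by omega)
    (hasIrreducibleModPGaloisRep_freyCurve_denes_of_mazurKenku hMK h h0 Fact.out h5) hρ

/-- The statement of `isAbsolutelyIrreducible_freyCurve_denes_of_mazurKenku` is not vacuous: the
Frey curve of a solution with `a b c ≠ 0` is an elliptic curve, so for every prime `q` it has a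
framed mod `q` representation `ρ̄_{E,q} : Γ_ℚ →ₜ* GL₂(𝔽_q)` (the tree's `exists_isTorsionGaloisRep`,
Silverman *AEC* III.7). [folklore] -/
theorem exists_isTorsionGaloisRep_freyCurve_denes (h : a ^ p + b ^ p = 2 * c ^ p)
    (h0 : a * b * c ≠ 0) (q : ℕ) [Fact q.Prime] :
    ∃ ρ : ModPGaloisRep ℚ (ZMod q) 2, (freyCurve (a ^ p) (-(2 * c ^ p))).IsTorsionGaloisRep q ρ :=
  haveI := isElliptic_freyCurve (denes_root_datum_ne_zero h h0)
  haveI : NeZero (q : ℚ) := ⟨Nat.cast_ne_zero.mpr (Fact.out : q.Prime).ne_zero⟩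
  exists_isTorsionGaloisRep _ q

end DenesModP

end Literature.NumberTheory.DiophantineGeometry
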